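import Mathlib
import Literature.Probability.Process.PointStationaryLaw
import Literature.MathematicalPhysics.StatisticalMechanics.RootEnergy
import Literature.MathematicalPhysics.StatisticalMechanics.LennardJonesClusters
import Summits.AtomisticToContinuum.Crystallization.Theorems.MinimiserShells.Negative.Rootedness

/-!
# Minimising laws charge no slabs (stub `stub_noSlabs` of line `purity_stacking`, crux
# `IsometryAtoms.MinimisingLawsCohesive`, stmt-AtomisticToContinuum-15777), helper 1:
# stacking events, slab covering, a.s.-invariant conditioning

Support file for the registered stub `stub_noSlabs` (a minimising point-stationary hard-core
Lennard-Jones law a.s. charges no slab configuration; proof by STACKING translates along a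
coordinate axis).  Contents (namespace `…IsometryAtomsMinimisingLawsCohesive.NoSlabs`):

* the **stacking event** of a period vector `v` — configurations `μ` with
  `μ (ball cₙ r) = 0 ∨ μ (ball (cₙ - k v) (1 - r)) = 0` for all `k ≠ 0`, all points `cₙ` of a dense
  sequence and all radii `r = 1/(a+1)` — is Giry-measurable (`measurableSet_stackEvent`) and, on
  counting measures `count|S`, is exactly "no bad pair": `1 ≤ ‖s - s' - k v‖` for `s, s' ∈ S`,
  `k ≠ 0` (`count_restrict_mem_stackEvent_iff`), a translation-invariant property
  (`map_sub_count_restrict_mem_stackEvent_iff`);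
* **slab covering** (`noSlabs_exists_noBadPair_of_slab`, the anchor): if the heights `|A s 0|`
  (`A` a linear isometry) are bounded on `S`, then `S` has no bad pair for some `v = t e_j`,
  `j : Fin 3`, `t ∈ ℕ`, `t ≥ 2` — so slab configurations are covered by COUNTABLY many stacking
  events with constant period;
* the a.e.-variants `isPointStationaryLaw_restrict_of_ae`, `meanRootEnergy_cond_le_of_minimising_ae`
  of the conditioning toolkit of `MinimiserShells.Negative.Rootedness` (invariance of the event
  under re-rooting only for a.e. configuration and a.e. point).
-/

noncomputable section

open MeasureTheory Set Filter Metric TopologicalSpace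
open scoped ENNReal

namespace Summit.AtomisticToContinuum.Crystallization.Theorems.IsometryAtomsMinimisingLawsCohesive.NoSlabs

open Literature.Probability.Process
open Literature.MathematicalPhysics.StatisticalMechanics (lennardJones)
open Summit.AtomisticToContinuum.Crystallization.Theorems.MinimiserShells.Negative.LoadBearing
  (eStar meanRootEnergy)

/-! ## The stacking events

For a period vector `v`, the *stacking event* is the set of configurations `μ` such that for every
`k ≠ 0` and every small rational ball `B = ball cₙ r`, `r = 1/(a+1)`, one of `μ B`,
`μ (ball (cₙ - k v) (1 - r))` vanishes.  For a counting measure `count|S` this says exactly that no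
difference `s - s'` of points of `S` is within distance `< 1` of a nonzero multiple `k v`
("no bad pair"), a translation-invariant property of `S`. -/

/-- The stacking event of the period vector `v` is measurable in the Giry σ-algebra (countably many
evaluations at open balls). -/
theorem measurableSet_stackEvent (v : EuclideanSpace ℝ (Fin 3)) :
    MeasurableSet {μ : Measure (EuclideanSpace ℝ (Fin 3)) | ∀ k : ℤ, k ≠ 0 → ∀ n a : ℕ,
      μ (Metric.ball (TopologicalSpace.denseSeq (EuclideanSpace ℝ (Fin 3)) n) (1 / ((a : ℝ) + 1))) = 0 ∨
      μ (Metric.ball (TopologicalSpace.denseSeq (EuclideanSpace ℝ (Fin 3)) n - (k : ℝ) • v)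
        (1 - 1 / ((a : ℝ) + 1))) = 0} := by
  refine measurableSet_setOf.2 (Measurable.forall fun k => Measurable.imp measurable_const
    (Measurable.forall fun n => Measurable.forall fun a => Measurable.or ?_ ?_))
  · exact (Measure.measurable_coe measurableSet_ball).eq_const 0
  · exact (Measure.measurable_coe measurableSet_ball).eq_const 0

/-- **The stacking event on counting measures is "no bad pair".** `count|S` lies in the stacking
event of `v` iff `1 ≤ ‖s - s' - k v‖` for all `s, s' ∈ S` and all `k ≠ 0`. -/
theorem count_restrict_mem_stackEvent_iff (S : Set (EuclideanSpace ℝ (Fin 3)))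
    (v : EuclideanSpace ℝ (Fin 3)) :
    (Measure.count : Measure (EuclideanSpace ℝ (Fin 3))).restrict S ∈
      {μ : Measure (EuclideanSpace ℝ (Fin 3)) | ∀ k : ℤ, k ≠ 0 → ∀ n a : ℕ,
        μ (Metric.ball (TopologicalSpace.denseSeq (EuclideanSpace ℝ (Fin 3)) n) (1 / ((a : ℝ) + 1))) = 0 ∨
        μ (Metric.ball (TopologicalSpace.denseSeq (EuclideanSpace ℝ (Fin 3)) n - (k : ℝ) • v)
          (1 - 1 / ((a : ℝ) + 1))) = 0} ↔
    ∀ s ∈ S, ∀ s' ∈ S, ∀ k : ℤ, k ≠ 0 → 1 ≤ ‖s - s' - (k : ℝ) • v‖ := by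
  have hne : ∀ A : Set (EuclideanSpace ℝ (Fin 3)), MeasurableSet A →
      ((Measure.count : Measure (EuclideanSpace ℝ (Fin 3))).restrict S A ≠ 0 ↔ (A ∩ S).Nonempty) := by
    intro A hA
    rw [Measure.restrict_apply hA, Measure.count_ne_zero_iff]
  simp only [mem_setOf_eq]
  constructor
  · intro h s hs s' hs' k hk
    by_contra hlt
    push Not at hlt
    obtain ⟨a, ha⟩ := exists_nat_one_div_lt (by linarith : 0 < (1 - ‖s - s' - (k : ℝ) • v‖) / 2)
    set r : ℝ := 1 / ((a : ℝ) + 1) with hr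
    have hr0 : 0 < r := by positivity
    obtain ⟨n, hn⟩ := (denseRange_denseSeq (EuclideanSpace ℝ (Fin 3))).exists_dist_lt s hr0
    set c := denseSeq (EuclideanSpace ℝ (Fin 3)) n with hc
    rcases h k hk n a with h0 | h0
    · exact (hne _ measurableSet_ball).2 ⟨s, mem_ball.2 hn, hs⟩ h0
    · refine (hne _ measurableSet_ball).2 ⟨s', ?_, hs'⟩ h0
      rw [mem_ball, dist_eq_norm]
      have heq : s' - (c - (k : ℝ) • v) = (s - c) - (s - s' - (k : ℝ) • v) := by abel
      rw [heq]
      rw [dist_eq_norm] at hn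
      calc ‖(s - c) - (s - s' - (k : ℝ) • v)‖ ≤ ‖s - c‖ + ‖s - s' - (k : ℝ) • v‖ := norm_sub_le _ _
        _ < 1 - r := by linarith
  · intro h k hk n a
    by_contra hboth
    push Not at hboth
    obtain ⟨h1, h2⟩ := hboth
    obtain ⟨s, hsb, hs⟩ := (hne _ measurableSet_ball).1 h1
    obtain ⟨s', hsb', hs'⟩ := (hne _ measurableSet_ball).1 h2
    have hle := h s hs s' hs' k hk
    rw [mem_ball, dist_eq_norm] at hsb hsb'
    set c := denseSeq (EuclideanSpace ℝ (Fin 3)) n with hc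
    have heq : s - s' - (k : ℝ) • v = (s - c) - (s' - (c - (k : ℝ) • v)) := by abel
    rw [heq] at hle
    have := norm_sub_le (s - c) (s' - (c - (k : ℝ) • v))
    linarith

/-- "No bad pair" is invariant under translation of the point set. -/
theorem noBadPair_image_sub_iff (S : Set (EuclideanSpace ℝ (Fin 3))) (v y : EuclideanSpace ℝ (Fin 3)) :
    (∀ s ∈ (fun z => z - y) '' S, ∀ s' ∈ (fun z => z - y) '' S, ∀ k : ℤ, k ≠ 0 →
        1 ≤ ‖s - s' - (k : ℝ) • v‖) ↔
      ∀ s ∈ S, ∀ s' ∈ S, ∀ k : ℤ, k ≠ 0 → 1 ≤ ‖s - s' - (k : ℝ) • v‖ := by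
  simp only [forall_mem_image, sub_sub_sub_cancel_right]

/-- **Re-rooting invariance of the stacking event on counting measures**: for `μ = count|S` and
every `y`, `θ_y μ = count|(S - y)` lies in the stacking event iff `μ` does. -/
theorem map_sub_count_restrict_mem_stackEvent_iff (S : Set (EuclideanSpace ℝ (Fin 3)))
    (v y : EuclideanSpace ℝ (Fin 3)) :
    ((Measure.count : Measure (EuclideanSpace ℝ (Fin 3))).restrict S).map (fun z => z - y) ∈
      {μ : Measure (EuclideanSpace ℝ (Fin 3)) | ∀ k : ℤ, k ≠ 0 → ∀ n a : ℕ,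
        μ (Metric.ball (TopologicalSpace.denseSeq (EuclideanSpace ℝ (Fin 3)) n) (1 / ((a : ℝ) + 1))) = 0 ∨
        μ (Metric.ball (TopologicalSpace.denseSeq (EuclideanSpace ℝ (Fin 3)) n - (k : ℝ) • v)
          (1 - 1 / ((a : ℝ) + 1))) = 0} ↔
    (Measure.count : Measure (EuclideanSpace ℝ (Fin 3))).restrict S ∈
      {μ : Measure (EuclideanSpace ℝ (Fin 3)) | ∀ k : ℤ, k ≠ 0 → ∀ n a : ℕ,
        μ (Metric.ball (TopologicalSpace.denseSeq (EuclideanSpace ℝ (Fin 3)) n) (1 / ((a : ℝ) + 1))) = 0 ∨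
        μ (Metric.ball (TopologicalSpace.denseSeq (EuclideanSpace ℝ (Fin 3)) n - (k : ℝ) • v)
          (1 - 1 / ((a : ℝ) + 1))) = 0} := by
  rw [map_sub_count_restrict, count_restrict_mem_stackEvent_iff, count_restrict_mem_stackEvent_iff,
    noBadPair_image_sub_iff]

/-! ## Slabs have no bad pair along a coordinate axis -/

/-- **Slab covering.** If the heights `|A s 0|`, `A` a linear isometry, are bounded by `D` on `S`
(the points of `S` lie in a slab), then for some coordinate direction `e_j` and some period
`t ∈ ℕ`, `t ≥ 2`, `S` has no bad pair for `v = t e_j`: the unit normal `u = A⁻¹ e₀` of the slab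
has a coordinate `|u_j| > 1/2`, and `|⟨s - s' - k t e_j, u⟩| ≥ |k| t / 2 - 2 D ≥ 1`. -/
theorem noSlabs_exists_noBadPair_of_slab : ∀ S : Set (EuclideanSpace ℝ (Fin 3)),
    ∀ A : EuclideanSpace ℝ (Fin 3) →ₗᵢ[ℝ] EuclideanSpace ℝ (Fin 3), ∀ D : ℝ,
    (∀ s ∈ S, |A s 0| ≤ D) → ∃ j : Fin 3, ∃ t : ℕ, 2 ≤ t ∧ ∀ s ∈ S, ∀ s' ∈ S, ∀ k : ℤ, k ≠ 0 →
    1 ≤ ‖s - s' - (k : ℝ) • ((t : ℝ) • EuclideanSpace.single j (1 : ℝ))‖ := by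
  intro S A D hD
  set Ae := A.toLinearIsometryEquiv rfl with hAe
  set u : EuclideanSpace ℝ (Fin 3) := Ae.symm (EuclideanSpace.single 0 1) with hu
  have hinner : ∀ x : EuclideanSpace ℝ (Fin 3), inner ℝ x u = A x 0 := by
    intro x
    rw [hu, ← LinearIsometryEquiv.inner_map_eq_flip, EuclideanSpace.inner_single_right]
    simp [hAe]
  have hnorm : ‖u‖ = 1 := by
    rw [hu, LinearIsometryEquiv.norm_map]
    simp
  -- a big coordinate of the unit normal
  have hj : ∃ j : Fin 3, 1 / 2 < |u j| := by
    by_contra hcon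
    push Not at hcon
    have hsq : ‖u‖ ^ 2 = ∑ i, (u i) ^ 2 := EuclideanSpace.real_norm_sq_eq u
    rw [hnorm, Fin.sum_univ_three] at hsq
    have h0 := hcon 0
    have h1 := hcon 1
    have h2 := hcon 2
    have e0 : u 0 ^ 2 ≤ 1 / 4 := by nlinarith [abs_nonneg (u 0), sq_abs (u 0)]
    have e1 : u 1 ^ 2 ≤ 1 / 4 := by nlinarith [abs_nonneg (u 1), sq_abs (u 1)]
    have e2 : u 2 ^ 2 ≤ 1 / 4 := by nlinarith [abs_nonneg (u 2), sq_abs (u 2)]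
    linarith
  obtain ⟨j, hj⟩ := hj
  refine ⟨j, max 2 ⌈4 * |D| + 2⌉₊, le_max_left _ _, ?_⟩
  intro s hs s' hs' k hk
  set t : ℕ := max 2 ⌈4 * |D| + 2⌉₊ with ht
  have ht' : 4 * |D| + 2 ≤ (t : ℝ) :=
    (Nat.le_ceil _).trans (by exact_mod_cast le_max_right 2 _)
  have ht0 : (0 : ℝ) ≤ t := by positivity
  set w := s - s' - (k : ℝ) • ((t : ℝ) • EuclideanSpace.single j (1 : ℝ)) with hw
  have h1 : |inner ℝ w u| ≤ ‖w‖ := by simpa [hnorm] using abs_real_inner_le_norm w u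
  have h2 : inner ℝ w u = A s 0 - A s' 0 - (k : ℝ) * (t : ℝ) * u j := by
    rw [hw, inner_sub_left, inner_sub_left, hinner, hinner, inner_smul_left, inner_smul_left,
      EuclideanSpace.inner_single_left]
    simp only [Fin.isValue, map_intCast, map_natCast, Real.ringHom_apply, one_mul, sub_right_inj]
    ring
  have hk1 : (1 : ℝ) ≤ |(k : ℝ)| := by
    rw [← Int.cast_abs]
    exact_mod_cast Int.one_le_abs hk
  have hs1 := hD s hs
  have hs2 := hD s' hs'
  -- `|k t u_j| ≥ t / 2`
  have h3 : (t : ℝ) / 2 ≤ |(k : ℝ) * t * u j| := by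
    rw [abs_mul, abs_mul, abs_of_nonneg ht0]
    have : (t : ℝ) * (1 / 2) ≤ |(k : ℝ)| * t * |u j| := by
      calc (t : ℝ) * (1 / 2) = 1 * t * (1 / 2) := by ring
        _ ≤ |(k : ℝ)| * t * |u j| := by
          apply mul_le_mul _ hj.le (by norm_num) (by positivity)
          exact mul_le_mul_of_nonneg_right hk1 ht0
    linarith
  -- `|⟨w, u⟩| ≥ |k t u_j| - |A s 0| - |A s' 0|`
  have h4 : |(k : ℝ) * t * u j| - |A s 0| - |A s' 0| ≤ |inner ℝ w u| := by
    rw [h2]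
    have i1 := abs_sub_abs_le_abs_sub ((k : ℝ) * t * u j) (A s 0 - A s' 0)
    have i2 := abs_sub (A s 0) (A s' 0)
    have i3 : |(k : ℝ) * t * u j - (A s 0 - A s' 0)| = |A s 0 - A s' 0 - (k : ℝ) * t * u j| :=
      abs_sub_comm _ _
    linarith
  linarith [abs_nonneg D, le_abs_self D]

/-! ## Conditioning on an almost surely re-rooting-invariant event

The a.e.-variants of `Rootedness.isPointStationaryLaw_restrict` and
`Rootedness.meanRootEnergy_cond_le_of_minimising`: the invariance `θ_y μ ∈ A ↔ μ ∈ A` is only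
required for `P`-a.e. `μ` and `μ`-a.e. `y` (it enters the Mecke computation inside the two
integrals only). -/

/-- **Conditioning on an a.s. re-rooting-invariant event preserves point-stationarity.** -/
theorem isPointStationaryLaw_restrict_of_ae {P : Measure (Measure (EuclideanSpace ℝ (Fin 3)))}
    (hP : IsPointStationaryLaw P) {A : Set (Measure (EuclideanSpace ℝ (Fin 3)))} (hA : MeasurableSet A)
    (hinv : ∀ᵐ μ ∂P, ∀ᵐ y ∂μ,
      (Measure.map (fun z : EuclideanSpace ℝ (Fin 3) => z - y) μ ∈ A ↔ μ ∈ A)) :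
    IsPointStationaryLaw (P.restrict A) := by
  classical
  intro g hg
  set c : Measure (EuclideanSpace ℝ (Fin 3)) → ℝ≥0∞ := A.indicator fun _ => 1 with hc
  have hcm : Measurable c := measurable_const.indicator hA
  have hc_top : ∀ μ, c μ ≠ ⊤ := fun μ => by
    by_cases hμ : μ ∈ A
    · rw [hc, Set.indicator_of_mem hμ]; exact ENNReal.one_ne_top
    · rw [hc, Set.indicator_of_notMem hμ]; exact ENNReal.zero_ne_top
  have hc_map : ∀ (μ : Measure (EuclideanSpace ℝ (Fin 3))) (y : EuclideanSpace ℝ (Fin 3)),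
      (Measure.map (fun z : EuclideanSpace ℝ (Fin 3) => z - y) μ ∈ A ↔ μ ∈ A) →
      c (Measure.map (fun z => z - y) μ) = c μ := by
    intro μ y hiff
    by_cases hμ : μ ∈ A
    · rw [hc, Set.indicator_of_mem hμ, Set.indicator_of_mem (hiff.2 hμ)]
    · rw [hc, Set.indicator_of_notMem hμ, Set.indicator_of_notMem fun h => hμ (hiff.1 h)]
  have pull : ∀ F : Measure (EuclideanSpace ℝ (Fin 3)) → ℝ≥0∞,
      ∫⁻ μ in A, F μ ∂P = ∫⁻ μ, c μ * F μ ∂P := by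
    intro F
    rw [← lintegral_indicator hA]
    refine lintegral_congr fun μ => ?_
    by_cases hμ : μ ∈ A
    · rw [Set.indicator_of_mem hμ, hc, Set.indicator_of_mem hμ, one_mul]
    · rw [Set.indicator_of_notMem hμ, hc, Set.indicator_of_notMem hμ, zero_mul]
  have hg' : Measurable (Function.uncurry fun μ y => c μ * g μ y) :=
    (hcm.comp measurable_fst).mul hg
  rw [pull, pull]
  calc ∫⁻ μ, c μ * ∫⁻ y, g μ y ∂μ ∂P = ∫⁻ μ, ∫⁻ y, c μ * g μ y ∂μ ∂P := by
        refine lintegral_congr fun μ => ?_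
        rw [lintegral_const_mul' _ _ (hc_top μ)]
    _ = ∫⁻ μ, ∫⁻ y, c (Measure.map (fun z => z - y) μ) *
          g (Measure.map (fun z => z - y) μ) (-y) ∂μ ∂P := hP _ hg'
    _ = ∫⁻ μ, c μ * ∫⁻ y, g (Measure.map (fun z => z - y) μ) (-y) ∂μ ∂P := by
        refine lintegral_congr_ae (hinv.mono fun μ hμ => ?_)
        show ∫⁻ y, c (Measure.map (fun z => z - y) μ) * g (Measure.map (fun z => z - y) μ) (-y) ∂μ =
          c μ * ∫⁻ y, g (Measure.map (fun z => z - y) μ) (-y) ∂μ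
        rw [← lintegral_const_mul' _ _ (hc_top μ)]
        refine lintegral_congr_ae (hμ.mono fun y hy => ?_)
        show c (Measure.map (fun z => z - y) μ) * g (Measure.map (fun z => z - y) μ) (-y) =
          c μ * g (Measure.map (fun z => z - y) μ) (-y)
        rw [hc_map μ y hy]

/-- **The minimising face is closed under a.s.-invariant conditioning.** Given the energy floor
`e* ≤ E_P[h]` on the frame and `e* < 0`: conditioning a minimising point-stationary `δ`-hard-core
probability law on a measurable event of positive probability which is re-rooting invariant for
`P`-a.e. configuration and a.e. point gives a minimising law. -/
theorem meanRootEnergy_cond_le_of_minimising_ae (heneg : eStar < 0)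
    (hU : ∀ δ : ℝ, 0 < δ → ∀ P : Measure (Measure (EuclideanSpace ℝ (Fin 3))), IsProbabilityMeasure P →
      (∀ᵐ μ ∂P, IsRootedHardCore δ μ) → IsPointStationaryLaw P → eStar ≤ meanRootEnergy P)
    {δ : ℝ} (hδ : 0 < δ) (P : Measure (Measure (EuclideanSpace ℝ (Fin 3)))) [IsProbabilityMeasure P]
    (hcore : ∀ᵐ μ ∂P, IsRootedHardCore δ μ) (hstat : IsPointStationaryLaw P)
    (hE : meanRootEnergy P ≤ eStar) {A : Set (Measure (EuclideanSpace ℝ (Fin 3)))} (hA : MeasurableSet A)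
    (hinv : ∀ᵐ μ ∂P, ∀ᵐ y ∂μ,
      (Measure.map (fun z : EuclideanSpace ℝ (Fin 3) => z - y) μ ∈ A ↔ μ ∈ A))
    (hpA : P A ≠ 0) :
    meanRootEnergy ((P A)⁻¹ • P.restrict A) ≤ eStar := by
  set F : Measure (EuclideanSpace ℝ (Fin 3)) → ℝ := fun μ => (∫ y, lennardJones ‖y‖ ∂μ) / 2 with hF
  have hEdef : ∀ Q : Measure (Measure (EuclideanSpace ℝ (Fin 3))), meanRootEnergy Q = ∫ μ, F μ ∂Q :=
    fun Q => rfl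
  have hint : Integrable F P := by
    by_contra hni
    rw [hEdef, integral_undef hni] at hE
    linarith
  have hsplit : ∫ μ, F μ ∂P = (∫ μ in A, F μ ∂P) + ∫ μ in Aᶜ, F μ ∂P :=
    (integral_add_compl hA hint).symm
  -- the conditioned law on a measurable a.s.-invariant event `B` of positive probability
  have cond : ∀ (B : Set (Measure (EuclideanSpace ℝ (Fin 3)))), MeasurableSet B →
      (∀ᵐ μ ∂P, ∀ᵐ y ∂μ,
        (Measure.map (fun z : EuclideanSpace ℝ (Fin 3) => z - y) μ ∈ B ↔ μ ∈ B)) → P B ≠ 0 →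
      (P B).toReal * eStar ≤ ∫ μ in B, F μ ∂P ∧
        meanRootEnergy ((P B)⁻¹ • P.restrict B) = (P B).toReal⁻¹ * ∫ μ in B, F μ ∂P := by
    intro B hB hinvB hpB
    have hp_top : P B ≠ ⊤ := measure_ne_top P B
    set PB : Measure (Measure (EuclideanSpace ℝ (Fin 3))) := (P B)⁻¹ • P.restrict B with hPB
    haveI : IsProbabilityMeasure PB := ⟨by
      rw [hPB, Measure.smul_apply, Measure.restrict_apply MeasurableSet.univ, Set.univ_inter,
        smul_eq_mul, ENNReal.inv_mul_cancel hpB hp_top]⟩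
    have hstatB : IsPointStationaryLaw PB :=
      (isPointStationaryLaw_restrict_of_ae hstat hB hinvB).smul _
    have hcoreB : ∀ᵐ μ ∂PB, IsRootedHardCore δ μ := by
      rw [hPB]
      exact Measure.ae_smul_measure (ae_restrict_of_ae hcore) _
    have hEB : meanRootEnergy PB = (P B).toReal⁻¹ * ∫ μ in B, F μ ∂P := by
      rw [hEdef, hPB, integral_smul_measure, smul_eq_mul, ENNReal.toReal_inv]
    have hlow : eStar ≤ meanRootEnergy PB := hU δ hδ PB inferInstance hcoreB hstatB
    refine ⟨?_, hEB⟩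
    rw [hEB] at hlow
    have hpos : 0 < (P B).toReal := ENNReal.toReal_pos hpB hp_top
    calc (P B).toReal * eStar ≤ (P B).toReal * ((P B).toReal⁻¹ * ∫ μ in B, F μ ∂P) :=
          mul_le_mul_of_nonneg_left hlow hpos.le
      _ = ∫ μ in B, F μ ∂P := by rw [← mul_assoc, mul_inv_cancel₀ hpos.ne', one_mul]
  obtain ⟨hAlow, hEA⟩ := cond A hA hinv hpA
  have hposA : 0 < (P A).toReal := ENNReal.toReal_pos hpA (measure_ne_top P A)
  rw [hEA]
  -- it remains to see `∫_A F ≤ P(A)·e*`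
  suffices hmain : ∫ μ in A, F μ ∂P ≤ (P A).toReal * eStar by
    calc (P A).toReal⁻¹ * ∫ μ in A, F μ ∂P ≤ (P A).toReal⁻¹ * ((P A).toReal * eStar) :=
          mul_le_mul_of_nonneg_left hmain (inv_pos.2 hposA).le
      _ = eStar := by rw [← mul_assoc, inv_mul_cancel₀ hposA.ne', one_mul]
  have hsum : (P A).toReal + (P Aᶜ).toReal = 1 := by
    rw [← ENNReal.toReal_add (measure_ne_top P A) (measure_ne_top P Aᶜ),
      measure_add_measure_compl hA, measure_univ, ENNReal.toReal_one]
  by_cases hqA : P Aᶜ = 0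
  · have h0 : ∫ μ in Aᶜ, F μ ∂P = 0 := by
      rw [Measure.restrict_eq_zero.2 hqA, integral_zero_measure]
    have h1 : (P A).toReal = 1 := by
      rw [hqA, ENNReal.toReal_zero, add_zero] at hsum
      exact hsum
    have h2 : ∫ μ in A, F μ ∂P = meanRootEnergy P := by
      rw [hEdef, hsplit, h0, add_zero]
    rw [h1, one_mul, h2]
    exact hE
  · have hinvc : ∀ᵐ μ ∂P, ∀ᵐ y ∂μ,
        (Measure.map (fun z : EuclideanSpace ℝ (Fin 3) => z - y) μ ∈ Aᶜ ↔ μ ∈ Aᶜ) :=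
      hinv.mono fun μ hμ => hμ.mono fun y hy => not_congr hy
    obtain ⟨hAclow, -⟩ := cond Aᶜ hA.compl hinvc hqA
    have hEP : ∫ μ, F μ ∂P ≤ eStar := by rw [← hEdef]; exact hE
    rw [hsplit] at hEP
    nlinarith

end Summit.AtomisticToContinuum.Crystallization.Theorems.IsometryAtomsMinimisingLawsCohesive.NoSlabs

end
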